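import Summits.BirchSwinnertonDyer.Rank1Residual.Additive.KatoDescentTorsionFree
import Summits.BirchSwinnertonDyer.Rank1Residual.Additive.O7RankOneCells
import Summits.BirchSwinnertonDyer.Rank1Residual.O6.O6Targets
import HarnessLib

/-!
# O6 / X3 (wild `3`, `W[3]` reducible): the KMC shell `O6.X3WildOfKMC` PROVED over the image-free
# torsion-free readings — `KMC₃` (⊕ PR^× in rank one) at ONE member with `3 ∤ #W′(ℚ)_tors` gives the
# `3`-part of BSD for EVERY member of the class; plus the type-blind X3 / small-image statements at
# any odd additive potentially good `p`, the B8 (O7-ss) rows off (12.5.2), and (§4) the K9/B4 class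
# statements `O6Sharp` / `O5Sharp` modulo KMC⁺ ⊕ PR^× at torsion-free members (route glue)
# (cell `bsd-potss`, seat `kmc`, generation 3; part 9 of the descent files; consumer of parts 8a/8b)

HONEST FRAMING (cell `bsd-potss`, `run/shared/lean/pub/bsd-potss/`, FULL-BSD rank-`≤ 1` programme
tranche 1b, row B5 = O6 wild `3`, its X3 half = 18 852 S-b pairs (9 476 r0 / 9 376 r1), rows B4
((t′) ∩ X3 at `p ≥ 5`: 1 063 S-b pairs) and B8; typed against cell `b2b-bsdres`'s shells
`O6/O6Targets.lean` / `Additive/O7RankOneCells.lean`): NOTHING about Kato's Main Conjecture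
(interface `KMC`, read through `ReadsTrivialKMC`) or Perrin-Riou's conjecture (node
`PerrinRiouUpToUnitAt`) is asserted; no Literature fact is minted; the readings of part 8a
(`TorsionFree.DescentCountReading` / `RankOneCountReading` / `HasPRRatio` / `RealizableOfKMC`) and the
published facts Cassels (`bsdRHS_eq_of_isIsogenous`), GZK, modularity are displayed binders. Census
numbers are not inputs; nothing is booked; no mark of `RESIDUAL-MAP.md` moves; X3 ∧ O6 stays OPEN.

## The slot and how it is filled (TARGET v5 §1.3 T-w-X3; o6-r1's `O6Targets.lean` §2)

`O6.X3WildOfKMC KMC isog` : `∀ W, r_an ≤ 1 → ClassX3 W 3 → SubW W 3 → (∃ W′ elliptic, globally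
minimal, isog W W′ ∧ KMC W′ 3) → MissingPPartAt W 3`, with TWO interface parameters: `KMC` and
`isog` ("`3`-power isogenous over `ℚ`; kept abstract here" — the planner's docstring names "the μ = 0
member"). Parts 1–7 could not touch it: their descent displayed Kato's (12.5.2), which EXCLUDES
`ClassX3` (`irr_of_imageContainsSL2`). Part 8 removed (12.5.2) in the direction KMC ⇒ BSD_p at the
price of ONE condition on the member, `p ∤ #W′(ℚ)_tors` (then `𝐇¹(T_pW′)⁰` is free, Conj. 12.10's own
integrality clause puts `z_γ` in it, Prop. 14.16's display and Greenberg's Prop. 4.13 are exact, and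
nothing else in Kato's §14 descent sees the image). So the slot is filled by
* `isog := O6.IsogTorsionFreeAt3` — "`W′` is `ℚ`-isogenous to `W`, additive and potentially good at
  `3` (isogeny-invariant in truth; displayed because the tree transports only good reduction along
  isogenies), and `3 ∤ #W′(ℚ)_tors`" — the class's torsion-free member (EVERY X3 ∧ O6 class has one:
  o6-r1 GEN 20 §0, 9 476 / 9 476 r0 classes, EVIDENCE; structurally, the walk quotienting by the
  rational `3`-torsion ends after ≤ 3 steps by Mazur–Kenku — not used, the member is a witness);
* `KMC := O6.KMCIntegralWithPerrinRiou KMC PRRatio` (KMC⁺) — Kato's Conj. 12.10⁰ for `T_3W′` WITH its printed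
  integrality clause (a stronger reading of the interface than parts 1–7 needed; planner g6 (δ)), PLUS, when `r_an = 1`,
  Perrin-Riou's formula up to a unit for `W′` (exactly as T-O6-A (A1) `O6.RankOneOfKMC KMC PR^× …`,
  part 6: in rank one KMC alone does not give BSD_p in Kato's currency; Burns–Kurihara–Sano Thm. 7.6).
  In analytic rank `0` the PR clause is idle and the statement is over `KMC` alone
  (`X3Wild.missingPPartAt_three_rankZero_of_kmc_member`).
`O6.x3WildOfKMC_of_torsionFree_readings` is then `O6.X3WildOfKMC (KMCIntegralWithPerrinRiou KMC PRRatio)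
IsogTorsionFreeAt3` — a THEOREM over the four image-free readings + Cassels + GZK + modularity. The
same descent is TYPE-BLIND: `X3.missingPPartAt_of_kmc_torsionFree_member` serves X3 ∩ (t′) at `p ≥ 5`
(50a1@5-type rows), and `O7.missingPPartAt_ss_of_kmc_of_perrinRiou_torsionFree` the B8 rows off
(12.5.2) (non-surjective irreducible images, and X3 via a member).

UPPER HALF WITHOUT KMC (record, not used): on X3 ∧ O6 ∧ r0 the Euler-system half is o6-r1's
theorem-candidate T-X3K `O6.KatoMemberShaBoundOfReducible` (`O6/X3KatoMemberBound.lean`; 12.5 (3) +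
Thm. 12.6 + Wuthrich L14, slack `t(W_K)`), whose readings `X3WildRankZero.*` close 9 329 / 9 476 r0
classes from ONE unit member WITHOUT any main conjecture; the present file is the MC-conditional road
for ALL X3 rows incl. the 144 all-`9 ∣ #Ш_an` classes and the 9 376 r1 pairs (modulo PR^×).

WHAT THIS IS NOT. Not a proof of KMC, PR^×, T-X3K or BSD₃ for any curve; no converse (BSD₃ ⇒ KMC needs
12.5 (4)'s divisibility, unavailable for reducible `W[3]`); the existence of a torsion-free member is a
displayed witness, not proved; nothing at `p = 2`, nothing potentially multiplicative; X3 ∧ O6 stays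
OPEN and no census number is an input. Net debt: two interface-filling `def`s (`KMCIntegralWithPerrinRiou`,
`IsogTorsionFreeAt3`; abbreviations, nothing asserted) and theorems; no `sorry`, axioms standard.

References: K. Kato, Astérisque 295 (2004) Conj. 12.10 (p. 224), Thm. 12.5 (4) and (12.5.2) (p. 222),
§14.14 (p. 243), Prop. 14.16 (p. 244) [Kato2004Asterisque]; D. Burns, M. Kurihara, T. Sano, JMSJ 76
(2024) = arXiv:1910.07404, Conj. 1.5, Thm. 7.6, Remark 7.7 [BurnsKuriharaSano2019]; J. W. S. Cassels,
J. reine angew. Math. 217 (1965) [Cassels1965ArithmeticVIII]; B. Mazur, Invent. Math. 44 (1978) and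
M. A. Kenku, J. Number Theory 15 (1982) (rational cyclic `3`-power isogenies have degree ≤ 27) [Mazur1978]
[Kenku1982]; R. L. Miller, LMS JCM 14 (2011) Def. 1.1 [Miller2011LMS].
-/

set_option autoImplicit false

noncomputable section

open scoped Classical

open WeierstrassCurve Literature.NumberTheory.EllipticCurves
  Literature.NumberTheory.EllipticCurves.ModularForms
  Literature.NumberTheory.EllipticCurves.Rank1Residual
  Literature.NumberTheory.EllipticCurves.Rank1Residual.Typed
  Literature.NumberTheory.EllipticCurves.IwasawaAlgebra
  Summit.BirchSwinnertonDyer.Rank1Residual.Additive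

namespace Summit.BirchSwinnertonDyer.Rank1Residual

/-! ## §1 The two interface fillers (abbreviations; nothing asserted) -/

/-- **KMC⁺ — the `KMC` slot of `O6.X3WildOfKMC`, filled by "Kato's Conj. 12.10⁰ for `T_pW` AS
PRINTED, i.e. WITH its integrality clause `Z(f,T)_𝔮 ⊂ 𝐇¹(T)_𝔮` (read by part 8a's
`TorsionFree.RealizableOfKMC`) as well as its length clause (read by part 1's `ReadsTrivialKMC`),
plus — when `r_an(W) = 1` — Perrin-Riou's 'Kato point' formula up to a unit for `W`"** (the rank-one
companion PR^× = `Additive.PerrinRiouUpToUnitAt PRRatio W p`, Burns–Kurihara–Sano Conj. 1.5; idle in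
rank `0`). Labelled KMC⁺ (planner g6 (δ)): a STRONGER use of the interface `KMC` than parts 1–7's,
where (12.5.2) made the integrality clause a theorem (Thm. 12.5 (4)). Both conjuncts are interfaces /
a conjecture node; nothing asserted.
[cite: Kato2004Asterisque, Conj. 12.10 (p. 224)] [cite: BurnsKuriharaSano2019, Conj. 1.5 and Remark 1.7 (i) (p. 5)] -/
def O6.KMCIntegralWithPerrinRiou
    (KMC : ∀ (W : WeierstrassCurve ℚ) [W.IsElliptic] [W.IsGloballyMinimal] (p : ℕ), Prop)
    (PRRatio : ∀ (W : WeierstrassCurve ℚ) [W.IsElliptic] [W.IsGloballyMinimal] (p : ℕ)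
      [Fact p.Prime], ℚ_[p] → Prop)
    (W : WeierstrassCurve ℚ) [W.IsElliptic] [W.IsGloballyMinimal] (p : ℕ) : Prop :=
  KMC W p ∧ ∀ [Fact p.Prime], W.analyticRank = 1 → PerrinRiouUpToUnitAt PRRatio W p

/-- **The `isog` slot of `O6.X3WildOfKMC`, filled by "`W′` is `ℚ`-isogenous to `W`, additive and
potentially good at `3`, and has NO rational `3`-torsion"** — the class's torsion-free member, at
which the image-free descent of part 8 runs (additivity / potential good reduction at `3` are
isogeny-invariant in truth, carried because the tree transports only good reduction along isogenies).
A predicate; nothing asserted. [cite: Kato2004Asterisque, Conj. 12.10 (p. 224)] [cite: Mazur1978, Thm. 1] [cite: Kenku1982, Thm. 1] -/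
def O6.IsogTorsionFreeAt3 (W W' : WeierstrassCurve ℚ) : Prop :=
  IsIsogenous W W' ∧ Addv W' 3 ∧ (∀ [W'.IsElliptic], 0 ≤ padicValRat 3 W'.j) ∧ ¬ 3 ∣ W'.torsionOrder

section Consumers

variable {IsOf : ∀ (W : WeierstrassCurve ℚ) [W.IsElliptic] [W.IsGloballyMinimal] (p : ℕ) [Fact p.Prime],
  KatoDescentDatum p → Prop}
variable {PRRatio : ∀ (W : WeierstrassCurve ℚ) [W.IsElliptic] [W.IsGloballyMinimal] (p : ℕ)
  [Fact p.Prime], ℚ_[p] → Prop}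
variable {KMC : ∀ (W : WeierstrassCurve ℚ) [W.IsElliptic] [W.IsGloballyMinimal] (p : ℕ), Prop}

/-! ## §2 T-w-X3: the shell `O6.X3WildOfKMC` over the torsion-free readings -/

/-- **T-w-X3 — `O6.X3WildOfKMC (KMCIntegralWithPerrinRiou KMC PRRatio) IsogTorsionFreeAt3` FOLLOWS from the
image-free readings** (parts 8a/8b) + Cassels + GZK + modularity: for `W` globally minimal with
`r_an ≤ 1`, `ClassX3 W 3`, `SubW W 3`, and a globally minimal member `W′ ∼ W` (additive potentially
good at `3`, `3 ∤ #W′(ℚ)_tors`) carrying KMC₃ (and PR^× if `r_an = 1`): `MissingPPartAt W 3`. The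
descent runs at `W′` (`TorsionFree.bsdp_of_kmc_of_perrinRiou`), Cassels transports
(`TorsionFree.missingPPartAt_of_isIsogenous_of_kmc`); the X3 binders of `W` itself are not even used
— reducibility is no obstruction once (12.5.2) is gone. Nothing is credited.
[cite: Kato2004Asterisque, Conj. 12.10 (p. 224), §14.14 (p. 243), Prop. 14.16 (p. 244)]
[cite: BurnsKuriharaSano2019, Thm. 7.6 (p. 29)] [cite: Cassels1965ArithmeticVIII] [cite: Miller2011LMS, §1 and Def. 1.1] -/
theorem O6.x3WildOfKMC_of_torsionFree_readings (hR : TorsionFree.DescentCountReading IsOf)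
    (hC : TorsionFree.RankOneCountReading IsOf PRRatio) (hreal : TorsionFree.RealizableOfKMC IsOf KMC)
    (hread : ReadsTrivialKMC IsOf KMC) (hCassels : bsdRHS_eq_of_isIsogenous)
    (hGZK : rank_eq_analyticRank_of_analyticRank_le_one) (hmod : hasEntireLFunction_rat) :
    O6.X3WildOfKMC (O6.KMCIntegralWithPerrinRiou KMC PRRatio) O6.IsogTorsionFreeAt3 := by
  intro W _ _ hr _ _ hex
  obtain ⟨W', _, _, ⟨hiso, hadd', hj', ht'⟩, hKMC', hPR'⟩ := hex
  exact TorsionFree.missingPPartAt_of_isIsogenous_of_kmc hR hC hreal hread hCassels hGZK hmod W W' 3 hiso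
    hr (by decide) hadd' hj' ht' (fun h1 ↦ hPR' h1) hKMC'

/-- **T-w-X3, rank `0`, over `KMC` ALONE (literal form):** for `W` globally minimal with `r_an = 0`,
`ClassX3 W 3`, `SubW W 3`, and a globally minimal member `W′ ∼ W`, additive potentially good at `3`
with `3 ∤ #W′(ℚ)_tors` and `KMC W′ 3`: `MissingPPartAt W 3` — both halves of the `3`-part, all 9 476
X3 ∧ O6 ∧ r0 classes in scope modulo KMC₃ at their torsion-free member (the 144 all-`9 ∣ #Ш_an`
classes of o6-r1 GEN 21 included). [cite: Kato2004Asterisque, Conj. 12.10 (p. 224), Prop. 14.16 (p. 244)] [cite: Cassels1965ArithmeticVIII] -/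
theorem O6.X3Wild.missingPPartAt_three_rankZero_of_kmc_member (hR : TorsionFree.DescentCountReading IsOf)
    (hreal : TorsionFree.RealizableOfKMC IsOf KMC) (hread : ReadsTrivialKMC IsOf KMC)
    (hCassels : bsdRHS_eq_of_isIsogenous) (hGZK : rank_eq_analyticRank_of_analyticRank_le_one)
    (hmod : hasEntireLFunction_rat)
    (W : WeierstrassCurve ℚ) [W.IsElliptic] [W.IsGloballyMinimal] (hr : W.analyticRank = 0)
    (_hX : ClassX3 W 3) (_hW : SubW W 3)
    (W' : WeierstrassCurve ℚ) [W'.IsElliptic] [W'.IsGloballyMinimal] (hiso : IsIsogenous W W')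
    (hadd' : Addv W' 3) (hj' : 0 ≤ padicValRat 3 W'.j) (ht' : ¬ 3 ∣ W'.torsionOrder)
    (hKMC' : KMC W' 3) : MissingPPartAt W 3 := by
  haveI : Finite W.sha := (hGZK W (by rw [hr]; exact zero_le_one)).2
  exact missingPPartAt_of_bsdp W 3 (TorsionFree.bsdp_rankZero_of_isIsogenous_of_kmc hR hreal hread
    hCassels hGZK hmod W W' 3 hiso hr (by decide) hadd' hj' ht' hKMC')

/-- **T-w-X3 at the torsion-free member ITSELF (no isogeny), rank `≤ 1`:** `ClassX3 W 3`, `SubW W 3`,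
`3 ∤ #W(ℚ)_tors`, `KMC W 3` (+ PR^× if `r_an = 1`) ⇒ `MissingPPartAt W 3`. (The 4 611 generic-χ X3 ∧ O6
∧ r0 classes have ALL members torsion-free, o6-r1 GEN 20 §0.)
[cite: Kato2004Asterisque, Conj. 12.10 (p. 224), Prop. 14.16 (p. 244)] [cite: BurnsKuriharaSano2019, Thm. 7.6 (p. 29)] -/
theorem O6.X3Wild.missingPPartAt_three_of_kmc_torsionFree (hR : TorsionFree.DescentCountReading IsOf)
    (hC : TorsionFree.RankOneCountReading IsOf PRRatio) (hreal : TorsionFree.RealizableOfKMC IsOf KMC)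
    (hread : ReadsTrivialKMC IsOf KMC) (hGZK : rank_eq_analyticRank_of_analyticRank_le_one)
    (hmod : hasEntireLFunction_rat)
    (W : WeierstrassCurve ℚ) [W.IsElliptic] [W.IsGloballyMinimal] (hr : W.analyticRank ≤ 1)
    (hX : ClassX3 W 3) (hW : SubW W 3) (ht : ¬ 3 ∣ W.torsionOrder)
    (hPR : W.analyticRank = 1 → PerrinRiouUpToUnitAt PRRatio W 3) (hKMC : KMC W 3) :
    MissingPPartAt W 3 :=
  TorsionFree.missingPPartAt_of_kmc_of_perrinRiou W 3 hR hC hreal hread hGZK hmod hr (by decide) hX.2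
    (not_lt.mp hW.1) ht hPR hKMC

/-! ## §3 Type-blind forms: X3 at any odd additive potentially good `p`; B8 off (12.5.2) -/

/-- **X3 (or any image) at an odd additive potentially good `p`, rank `≤ 1`: KMC (⊕ PR^×) at a
torsion-free member of the class ⇒ `MissingPPartAt W p`** — serves X3 ∩ (t′) at `p ≥ 5` (`e ∈ {3,4,6}`:
50a1@5, the `X₀(11)`/`X₀(17)`-isogeny families; TARGET v2 R22) and X3 ∩ O5 at `p = 3` alike; the
class binders of `W` are irrelevant to the descent and therefore not displayed.
[cite: Kato2004Asterisque, Conj. 12.10 (p. 224), Prop. 14.16 (p. 244)] [cite: BurnsKuriharaSano2019, Thm. 7.6 (p. 29)] [cite: Cassels1965ArithmeticVIII] -/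
theorem X3.missingPPartAt_of_kmc_torsionFree_member (hR : TorsionFree.DescentCountReading IsOf)
    (hC : TorsionFree.RankOneCountReading IsOf PRRatio) (hreal : TorsionFree.RealizableOfKMC IsOf KMC)
    (hread : ReadsTrivialKMC IsOf KMC) (hCassels : bsdRHS_eq_of_isIsogenous)
    (hGZK : rank_eq_analyticRank_of_analyticRank_le_one) (hmod : hasEntireLFunction_rat)
    (W W' : WeierstrassCurve ℚ) [W.IsElliptic] [W.IsGloballyMinimal] [W'.IsElliptic]
    [W'.IsGloballyMinimal] (p : ℕ) [Fact p.Prime] (hiso : IsIsogenous W W')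
    (hr : W.analyticRank ≤ 1) (hp : p ≠ 2) (hadd' : Addv W' p) (hj' : 0 ≤ padicValRat p W'.j)
    (ht' : ¬ p ∣ W'.torsionOrder) (hPR' : W'.analyticRank = 1 → PerrinRiouUpToUnitAt PRRatio W' p)
    (hKMC' : KMC W' p) : MissingPPartAt W p :=
  TorsionFree.missingPPartAt_of_isIsogenous_of_kmc hR hC hreal hread hCassels hGZK hmod W W' p hiso hr
    hp hadd' hj' ht' hPR' hKMC'

/-- **B8 = O7-ss OFF (12.5.2), rank one: `KMC ∧ PR^× ⇒ MissingPPartAt`** at every analytic-rank-one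
pair of the O7-ss locus (`O7.SS W p`) with `p ∤ #W(ℚ)_tors` — part 6's `O7.missingPPartAt_ss_of_kmc_of_perrinRiou`
with the image hypothesis replaced by the torsion condition (non-surjective irreducible images, CM).
[cite: Kato2004Asterisque, Conj. 12.10 (p. 224)] [cite: BurnsKuriharaSano2019, Conj. 1.5 (p. 5), Thm. 7.6 (p. 29)] -/
theorem O7.missingPPartAt_ss_of_kmc_of_perrinRiou_torsionFree
    (hC : TorsionFree.RankOneCountReading IsOf PRRatio) (hreal : TorsionFree.RealizableOfKMC IsOf KMC)
    (hread : ReadsTrivialKMC IsOf KMC) (hGZK : rank_eq_analyticRank_of_analyticRank_le_one)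
    (hmod : hasEntireLFunction_rat)
    (W : WeierstrassCurve ℚ) [W.IsElliptic] [W.IsGloballyMinimal] (p : ℕ) [Fact p.Prime]
    (hr : W.analyticRank = 1) (hss : O7.SS W p) (ht : ¬ p ∣ W.torsionOrder)
    (hKMC : KMC W p) (hPR : PerrinRiouUpToUnitAt PRRatio W p) : MissingPPartAt W p :=
  TorsionFree.rankOne_missingPPartAt_of_kmc_of_perrinRiou W p hC hreal hread hGZK hmod hr hss.addv.1
    hss.addv.2 hss.padicValRat_j_nonneg ht hPR hKMC

/-- **O5 ∪ O6 rank `0` OFF (12.5.2): `KMC ⇒ MissingLowerBoundAt`** (the shared shell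
`O5.PotSupersingularLowerHalfRankZeroOfKMC`'s conclusion) at every pair of the pot-ss locus with
`p ∤ #W(ℚ)_tors` — part 2's `potSupersingularLowerHalfRankZeroOfKMC_of_readings` minus the image
hypothesis; the (t′)/wild CM and small-image r0 rows. [cite: Kato2004Asterisque, Conj. 12.10 (p. 224), Prop. 14.16 (p. 244)] -/
theorem O7.missingLowerBoundAt_ss_rankZero_of_kmc_torsionFree (hR : TorsionFree.DescentCountReading IsOf)
    (hreal : TorsionFree.RealizableOfKMC IsOf KMC) (hread : ReadsTrivialKMC IsOf KMC)
    (hGZK : rank_eq_analyticRank_of_analyticRank_le_one) (hmod : hasEntireLFunction_rat)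
    (W : WeierstrassCurve ℚ) [W.IsElliptic] [W.IsGloballyMinimal] (p : ℕ) [Fact p.Prime]
    (hr : W.analyticRank = 0) (hss : O7.SS W p) (ht : ¬ p ∣ W.torsionOrder) (hKMC : KMC W p) :
    MissingLowerBoundAt W p :=
  (lower_and_upper_of_missingPPartAt W p (TorsionFree.missingPPartAt_rankZero_of_kmc W p hR hreal hread
    hGZK hmod hr hss.addv.1 hss.addv.2 hss.padicValRat_j_nonneg ht hKMC)).1

/-! ## §4 The K9 class statements modulo KMC⁺ ⊕ PR^× at torsion-free members (route glue, D-0059/61):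
`X3SharpW`, `O6.X4SharpW`, hence `O6Sharp`; and `O5Sharp` — every O5/O6 pair, from the readings -/

/-- `W[p]` irreducible ⇒ `p ∤ #W(ℚ)_tors` (a rational point of order `p` spans a stable line).
[cite: Mazur1977, Ch. III §5, p. 157] -/
theorem not_dvd_torsionOrder_of_irr (W : WeierstrassCurve ℚ) [W.IsElliptic] (p : ℕ) [Fact p.Prime]
    (hirr : Irr W p) : ¬ p ∣ W.torsionOrder := by
  intro h
  have h0 : padicValNat p W.torsionOrder = 0 := padicValNat_torsionOrder_eq_zero_of_irreducible W p hirr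
  have h1 : 1 ≤ padicValNat p W.torsionOrder :=
    (padicValNat_dvd_iff_le W.torsionOrder_pos_holds.ne').mp (by simpa using h)
  omega

/-- **`O6.X4SharpW` (the X4 half of the K9 leaf `O6Sharp`) FOLLOWS from the image-free readings and
KMC⁺ ⊕ PR^× AT THE PAIR ITSELF** — on X4 (`W[p]` irreducible) the curve is its own torsion-free
member, so NO (12.5.2) is needed (parts 2/6 reached only the (12.5.2) rows of X4; the non-surjective
irreducible images — O8 — and the CM rows with irreducible `W[3]` are now included). Hypothesis:
KMC (and PR^× in rank one) at every X4-wild pair. Nothing credited.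
[cite: Kato2004Asterisque, Conj. 12.10 (p. 224), Prop. 14.16 (p. 244)] [cite: BurnsKuriharaSano2019, Thm. 7.6 (p. 29)] -/
theorem O6.x4SharpW_of_kmc_of_perrinRiou_torsionFree (hR : TorsionFree.DescentCountReading IsOf)
    (hC : TorsionFree.RankOneCountReading IsOf PRRatio) (hreal : TorsionFree.RealizableOfKMC IsOf KMC)
    (hread : ReadsTrivialKMC IsOf KMC) (hGZK : rank_eq_analyticRank_of_analyticRank_le_one)
    (hmod : hasEntireLFunction_rat)
    (hK : ∀ (W : WeierstrassCurve ℚ) [W.IsElliptic] [W.IsGloballyMinimal] (p : ℕ) [Fact p.Prime],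
      W.analyticRank ≤ 1 → ClassX4 W p → SubW W p →
        KMC W p ∧ (W.analyticRank = 1 → PerrinRiouUpToUnitAt PRRatio W p)) :
    O6.X4SharpW := by
  intro W _ _ p _ hr hX hW
  obtain ⟨hKMC, hPR⟩ := hK W p hr hX hW
  exact TorsionFree.missingPPartAt_of_kmc_of_perrinRiou W p hR hC hreal hread hGZK hmod hr hX.1 hX.2.1
    (not_lt.mp hW.1) (not_dvd_torsionOrder_of_irr W p hX.2.2) hPR hKMC

/-- **`X3SharpW` (the X3 half of the K9 leaf `O6Sharp`) FOLLOWS from the image-free readings, Cassels,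
and "every X3-wild pair of analytic rank `≤ 1` has a torsion-free member carrying KMC⁺ (⊕ PR^× in rank
one)"** (the member: `ℚ`-isogenous, additive potentially good at `p`, `p ∤ #W′(ℚ)_tors`; exists for
every class by Mazur–Kenku — displayed, not proved). Nothing credited.
[cite: Kato2004Asterisque, Conj. 12.10 (p. 224)] [cite: BurnsKuriharaSano2019, Thm. 7.6 (p. 29)] [cite: Cassels1965ArithmeticVIII] -/
theorem x3SharpW_of_kmc_torsionFree_members (hR : TorsionFree.DescentCountReading IsOf)
    (hC : TorsionFree.RankOneCountReading IsOf PRRatio) (hreal : TorsionFree.RealizableOfKMC IsOf KMC)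
    (hread : ReadsTrivialKMC IsOf KMC) (hCassels : bsdRHS_eq_of_isIsogenous)
    (hGZK : rank_eq_analyticRank_of_analyticRank_le_one) (hmod : hasEntireLFunction_rat)
    (hmem : ∀ (W : WeierstrassCurve ℚ) [W.IsElliptic] [W.IsGloballyMinimal] (p : ℕ) [Fact p.Prime],
      W.analyticRank ≤ 1 → p ≠ 2 → ClassX3 W p → SubW W p →
        ∃ (W' : WeierstrassCurve ℚ) (_ : W'.IsElliptic) (_ : W'.IsGloballyMinimal),
          IsIsogenous W W' ∧ Addv W' p ∧ 0 ≤ padicValRat p W'.j ∧ ¬ p ∣ W'.torsionOrder ∧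
          KMC W' p ∧ (W'.analyticRank = 1 → PerrinRiouUpToUnitAt PRRatio W' p)) :
    X3SharpW := by
  intro W _ _ p _ hr hp hX hW
  obtain ⟨W', _, _, hiso, hadd', hj', ht', hKMC', hPR'⟩ := hmem W p hr hp hX hW
  exact X3.missingPPartAt_of_kmc_torsionFree_member hR hC hreal hread hCassels hGZK hmod W W' p hiso hr
    hp hadd' hj' ht' hPR' hKMC'

/-- **The K9 rung leaf `O6Sharp` (BSD₃'s missing `3`-part on EVERY wild pair of analytic rank `≤ 1`,
X3 ∪ X4) FOLLOWS from: the four image-free readings, Cassels, GZK, modularity, and KMC₃⁺ ⊕ PR^× at a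
torsion-free member of each class** (on X4 the pair itself; on X3 the displayed member) — via the
tree's `O6.o6Sharp_iff_x3SharpW_and_x4SharpW`. The closes-sketch of the K9 route in kernel form;
nothing is credited (KMC, PR^× and the readings are hypotheses, D-O6-2 stands).
[cite: Kato2004Asterisque, Conj. 12.10 (p. 224)] [cite: BurnsKuriharaSano2019, Thm. 7.6 (p. 29)] [cite: Cassels1965ArithmeticVIII] -/
theorem o6Sharp_of_kmc_torsionFree_members (hR : TorsionFree.DescentCountReading IsOf)
    (hC : TorsionFree.RankOneCountReading IsOf PRRatio) (hreal : TorsionFree.RealizableOfKMC IsOf KMC)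
    (hread : ReadsTrivialKMC IsOf KMC) (hCassels : bsdRHS_eq_of_isIsogenous)
    (hGZK : rank_eq_analyticRank_of_analyticRank_le_one) (hmod : hasEntireLFunction_rat)
    (hK4 : ∀ (W : WeierstrassCurve ℚ) [W.IsElliptic] [W.IsGloballyMinimal] (p : ℕ) [Fact p.Prime],
      W.analyticRank ≤ 1 → ClassX4 W p → SubW W p →
        KMC W p ∧ (W.analyticRank = 1 → PerrinRiouUpToUnitAt PRRatio W p))
    (hK3 : ∀ (W : WeierstrassCurve ℚ) [W.IsElliptic] [W.IsGloballyMinimal] (p : ℕ) [Fact p.Prime],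
      W.analyticRank ≤ 1 → p ≠ 2 → ClassX3 W p → SubW W p →
        ∃ (W' : WeierstrassCurve ℚ) (_ : W'.IsElliptic) (_ : W'.IsGloballyMinimal),
          IsIsogenous W W' ∧ Addv W' p ∧ 0 ≤ padicValRat p W'.j ∧ ¬ p ∣ W'.torsionOrder ∧
          KMC W' p ∧ (W'.analyticRank = 1 → PerrinRiouUpToUnitAt PRRatio W' p)) :
    O6Sharp :=
  O6.o6Sharp_iff_x3SharpW_and_x4SharpW.mpr
    ⟨x3SharpW_of_kmc_torsionFree_members hR hC hreal hread hCassels hGZK hmod hK3,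
      O6.x4SharpW_of_kmc_of_perrinRiou_torsionFree hR hC hreal hread hGZK hmod hK4⟩

/-- **`O5Sharp` (tame odd additive potentially supersingular pairs: Gss2 and (t′), X3 ∪ X4, r_an ≤ 1)
FOLLOWS from the same inputs at every O5 pair**: KMC_p⁺ ⊕ PR^× at a torsion-free member (`ℚ`-isogenous,
additive potentially good at `p`, `p ∤ #tors`; on X4 rows `W′ = W` qualifies). Type-blind twin of the
previous theorem for row B4. Nothing credited.
[cite: Kato2004Asterisque, Conj. 12.10 (p. 224)] [cite: BurnsKuriharaSano2019, Thm. 7.6 (p. 29)] [cite: Cassels1965ArithmeticVIII] -/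
theorem o5Sharp_of_kmc_torsionFree_members (hR : TorsionFree.DescentCountReading IsOf)
    (hC : TorsionFree.RankOneCountReading IsOf PRRatio) (hreal : TorsionFree.RealizableOfKMC IsOf KMC)
    (hread : ReadsTrivialKMC IsOf KMC) (hCassels : bsdRHS_eq_of_isIsogenous)
    (hGZK : rank_eq_analyticRank_of_analyticRank_le_one) (hmod : hasEntireLFunction_rat)
    (hmem : ∀ (W : WeierstrassCurve ℚ) [W.IsElliptic] [W.IsGloballyMinimal] (p : ℕ) [Fact p.Prime],
      W.analyticRank ≤ 1 → ClassO5 W p →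
        ∃ (W' : WeierstrassCurve ℚ) (_ : W'.IsElliptic) (_ : W'.IsGloballyMinimal),
          IsIsogenous W W' ∧ Addv W' p ∧ 0 ≤ padicValRat p W'.j ∧ ¬ p ∣ W'.torsionOrder ∧
          KMC W' p ∧ (W'.analyticRank = 1 → PerrinRiouUpToUnitAt PRRatio W' p)) :
    O5Sharp := by
  intro W _ _ p _ hr hO
  obtain ⟨W', _, _, hiso, hadd', hj', ht', hKMC', hPR'⟩ := hmem W p hr hO
  exact X3.missingPPartAt_of_kmc_torsionFree_member hR hC hreal hread hCassels hGZK hmod W W' p hiso hr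
    hO.1 hadd' hj' ht' hPR' hKMC'

end Consumers

end Summit.BirchSwinnertonDyer.Rank1Residual

end
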